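import Literature.NumberTheory.LFunctions.Polymath15NewUpperBound
import Literature.NumberTheory.LFunctions.Polymath15BarrierCert
import HarnessLib

/-!
# `Λ ≤ t₀ + y₀²/2` from a verified RH height and two certificates: the theorem shape, general parameters

Trunk T-ANT (`Literature/NumberTheory/LFunctions`); companion of `DeBruijnNewmanUpperBound.lean`
(Polymath 15, Thm. 1.2 = `Polymath15.upper_bound_criterion`, PROVED as
`Polymath15.upper_bound_criterion_holds`), `Polymath15NewUpperBound.lean` (Thm. 1.1 assembled at
the printed parameters, `Polymath15.new_upper_bound_of_rectangles`) and `Polymath15BarrierCert.lean`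
(the barrier box from a discrete winding certificate, `Polymath15.box_zero_free_of_windingCert`).

Those files fix the parameters of Polymath 15, Thm. 1.1 (`t₀ = y₀ = 0.2`, `X = 6·10¹⁰ + 83951.5`) or of
§10, Table 1, row 2 (`t₀ = 0.186`, `y₀ = 0.16733`, `X = 5·10¹² + 194858`). This file states the same
reductions ONCE for general parameters `(t₀, X, y₀)` and a general verified height `H ≥ X/2`, so that
every further bound `Λ ≤ c` obtained by the Polymath 15 / Platt–Trudgian method ("a theorem per bound")
is an instance whose hypotheses are exactly the deliverables of a computation:

* `Polymath15.upper_bound_of_rectangles` (PROVED) — **rectangle level.** `0 < t₀`, `0 < X`,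
  `0 < y₀ ≤ 1`, RH verified to height `H ≥ X/2` (`RiemannHypothesisUpTo H`: every zero `s` of `ζ`
  with `0 < Im s ≤ H` has `Re s = 1/2`), `H_{t₀} ≠ 0` on the half-strip `x ≥ X`, `y₀ ≤ y ≤ 1`, and
  `H_t ≠ 0` on the box `0 ≤ t ≤ t₀`, `X ≤ x ≤ X + 1`, `y₀ ≤ y ≤ 1` ⟹ `H_t` has only real zeros for
  every `t > t₀ + y₀²/2`. (Polymath 15, §1 after Thm. 1.2 and §8.2: hypothesis (i) from the RH
  verification since `X/2 ≤ H` — `Polymath15.initialZeroFree_of_numerical_rh`; (ii), (iii) from the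
  two rectangles — `Polymath15.final_and_barrier_of_rectangles`; then Thm. 1.2.)
  `Polymath15.deBruijnNewmanConst_le_of_rectangles`: the same as `Λ ≤ t₀ + y₀²/2`
  (`deBruijnNewmanConst_le_iff_holds`).
* `Polymath15.upper_bound_of_certificates` (PROVED, taking the named fact
  `Polymath15.effective_approximation` = Polymath 15, Thm. 1.3 as the hypothesis `h`; that fact is
  DISCHARGED since 2026-08-27 — `Polymath15.effective_approximation_holds`,
  `Polymath15EffectiveApproximationHolds.lean`, where the `h`-free forms of the theorems of this file
  are `upper_bound_of_certificates'`, `deBruijnNewmanConst_le_of_certificates'`,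
  `deBruijnNewmanConst_le_of_certificates_platt_trudgian'`,
  `deBruijnNewmanConst_le_one_fifth_of_row2_certificates'`) —
  **certificate level.** For `0 < t₀ ≤ 1/2`, `0 < y₀ < 1`, `X ≥ 200`, `H ≥ X/2`: RH to height `H`;
  on the box, the Riemann–Siegel length `N = ⌊√(x/4π + t/16)⌋` constant in `t` and the printed error
  majorant `errAB + errC0 ≤ μ`; for every `t ∈ [0, t₀]` a discrete winding certificate with margin
  `μ` for `z ↦ f_t(z)` on `[X, X+1] × [y₀, 1]` (`Polymath15.WindingCertGt`, the format of §8.4); and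
  on the half-strip `x ≥ X`, `y₀ ≤ y ≤ 1` the pointwise inequality `errAB + errC0 < |f_{t₀}(x+iy)|`
  (Cor. 1.4, the format of §8.3/§8.5) ⟹ `H_t` has only real zeros for every `t > t₀ + y₀²/2`.
  `Polymath15.deBruijnNewmanConst_le_of_certificates`: the `Λ`-form.
* `Polymath15.deBruijnNewmanConst_le_of_rectangles_platt_trudgian`,
  `Polymath15.deBruijnNewmanConst_le_of_certificates_platt_trudgian` (PROVED): the instances at the
  Platt–Trudgian height `H = 3 000 175 332 800` (named computational fact
  `Literature.NumberTheory.LFunctions.platt_trudgian_numerical_rh`, Bull. LMS 53 (2021), Thm. 1),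
  i.e. for every barrier location `X ≤ 6 000 350 665 600`.
* `Polymath15.deBruijnNewmanConst_le_one_fifth_of_row2_certificates` (PROVED, conditional on
  Thm. 1.3): the row-2 instance `Λ ≤ 1/5` from RH to any height `H ≥ 2 500 000 097 429`, a winding
  certificate with margin `1/500` for the row-2 box, and the row-2 tail inequality.

No definitions and no named facts are introduced. What is NOT reduced here: (1) Thm. 1.3 itself
(hypothesis `h : effective_approximation`; proved elsewhere in the tree, see above — feed
`effective_approximation_holds`, or use the primed forms); (2) the passage from finitely many `N`-interval
inequalities (Polymath 15, §8.5, Euler mollifiers and Lemma 8.2) to the pointwise hypothesis `htail`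
on the infinite half-strip — in print this is where §10 says of the Table 1 rows "we … expect to be
able to verify the hypothesis" (the barrier having been run for every row), so for those rows
`htail` is the part of the certificate that remains to be produced.

## References

* D. H. J. Polymath, *Effective approximation of heat flow evolution of the Riemann `ξ` function, and
  a new upper bound for the de Bruijn–Newman constant*, Res. Math. Sci. 6 (2019) 31
  (arXiv:1904.12438): Thm. 1.2, Thm. 1.3, Cor. 1.4, §1 (enlarged barrier), §8.2–8.5, §10 (Table 1 and
  the paragraph after Lemma 10.1).
* D. J. Platt, T. S. Trudgian, *The Riemann hypothesis is true up to `3·10¹²`*, Bull. Lond. Math.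
  Soc. 53 (2021) 792–797: Thm. 1, §3.4, Cor. 2.
-/

noncomputable section

open Complex Set

namespace Literature.NumberTheory.LFunctions

namespace Polymath15

/-! ## Rectangle level -/

/-- **`Λ ≤ t₀ + y₀²/2` from a verified RH height and two zero-free rectangles** (Polymath 15,
Thm. 1.2 with §1's enlarged barrier and §8.2's reduction, general parameters). Let `0 < t₀`,
`0 < X`, `0 < y₀ ≤ 1` and `X/2 ≤ H`. Assume (i′) RH up to height `H` (every zero `s` of `ζ` with
`0 < Im s ≤ H` has `Re s = 1/2`); (ii′) `H_{t₀}(x + iy) ≠ 0` for `x ≥ X`, `y₀ ≤ y ≤ 1`;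
(iii′) `H_t(x + iy) ≠ 0` for `0 ≤ t ≤ t₀`, `X ≤ x ≤ X + 1`, `y₀ ≤ y ≤ 1`. Then `H_t` has only real
zeros for every `t > t₀ + y₀²/2`. Proof: (i′) ⟹ (i) of Thm. 1.2 (`initialZeroFree_of_numerical_rh`:
a zero `σ + iT` with `σ ≥ (1+y₀)/2 > 1/2`, `0 < T ≤ X/2 ≤ H` contradicts (i′), and `ζ` has no real
zeros in `[(1+y₀)/2, 1]`); (ii′), (iii′) ⟹ (ii), (iii) (`final_and_barrier_of_rectangles`); Thm. 1.2
(`upper_bound_criterion_holds`). [cite: Polymath2019, Thm. 1.2 and §8.2] -/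
theorem upper_bound_of_rectangles {t₀ X y₀ H : ℝ} (ht₀ : 0 < t₀) (hX : 0 < X) (hy₀ : 0 < y₀)
    (hy₁ : y₀ ≤ 1) (hH : X / 2 ≤ H) (hRH : DiophantineGeometry.RiemannHypothesisUpTo H)
    (hii : ∀ x y : ℝ, X ≤ x → y₀ ≤ y → y ≤ 1 → deBruijnH t₀ (x + y * I) ≠ 0)
    (hiii : ∀ t x y : ℝ, 0 ≤ t → t ≤ t₀ → X ≤ x → x ≤ X + 1 → y₀ ≤ y → y ≤ 1 →
      deBruijnH t (x + y * I) ≠ 0) :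
    ∀ t : ℝ, t₀ + y₀ ^ 2 / 2 < t → HasOnlyRealZeros (deBruijnH t) := by
  obtain ⟨h₂, h₃⟩ := final_and_barrier_of_rectangles ht₀.le hy₀.le hii hiii
  exact upper_bound_criterion_holds t₀ X y₀ ht₀ hX hy₀ hy₁
    (initialZeroFree_of_numerical_rh hy₀ hH fun s hs h0 hT ↦ hRH s hs h0 hT) h₂ h₃

/-- The `Λ`-form of `upper_bound_of_rectangles`: under the same hypotheses,
`Λ ≤ t₀ + y₀²/2` (Newman's characterisation `deBruijnNewmanConst_le_iff_holds`).
[cite: Polymath2019, Thm. 1.2 and §8.2] -/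
theorem deBruijnNewmanConst_le_of_rectangles {t₀ X y₀ H : ℝ} (ht₀ : 0 < t₀) (hX : 0 < X)
    (hy₀ : 0 < y₀) (hy₁ : y₀ ≤ 1) (hH : X / 2 ≤ H)
    (hRH : DiophantineGeometry.RiemannHypothesisUpTo H)
    (hii : ∀ x y : ℝ, X ≤ x → y₀ ≤ y → y ≤ 1 → deBruijnH t₀ (x + y * I) ≠ 0)
    (hiii : ∀ t x y : ℝ, 0 ≤ t → t ≤ t₀ → X ≤ x → x ≤ X + 1 → y₀ ≤ y → y ≤ 1 →
      deBruijnH t (x + y * I) ≠ 0) :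
    deBruijnNewmanConst ≤ t₀ + y₀ ^ 2 / 2 :=
  (deBruijnNewmanConst_le_iff_holds _).2 (upper_bound_of_rectangles ht₀ hX hy₀ hy₁ hH hRH hii hiii)

/-- **Rectangle level at the Platt–Trudgian height.** With RH verified to height
`3 000 175 332 800` (`platt_trudgian_numerical_rh`, Platt–Trudgian 2021, Thm. 1), any barrier
location `0 < X` with `X/2 ≤ 3 000 175 332 800` and any `0 < t₀`, `0 < y₀ ≤ 1` for which the two
rectangles (ii′), (iii′) are zero-free give `Λ ≤ t₀ + y₀²/2`. (Platt–Trudgian 2021, §3.4: "Given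
that our value of `H` falls between the entries in this table, it is possible that some extra
decimals could be wrought out of the calculation.") [cite: PlattTrudgianBLMS2021, Thm. 1 and §3.4] -/
theorem deBruijnNewmanConst_le_of_rectangles_platt_trudgian (h₁ : LFunctions.platt_trudgian_numerical_rh)
    {t₀ X y₀ : ℝ} (ht₀ : 0 < t₀) (hX : 0 < X) (hy₀ : 0 < y₀) (hy₁ : y₀ ≤ 1)
    (hH : X / 2 ≤ 3000175332800)
    (hii : ∀ x y : ℝ, X ≤ x → y₀ ≤ y → y ≤ 1 → deBruijnH t₀ (x + y * I) ≠ 0)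
    (hiii : ∀ t x y : ℝ, 0 ≤ t → t ≤ t₀ → X ≤ x → x ≤ X + 1 → y₀ ≤ y → y ≤ 1 →
      deBruijnH t (x + y * I) ≠ 0) :
    deBruijnNewmanConst ≤ t₀ + y₀ ^ 2 / 2 :=
  deBruijnNewmanConst_le_of_rectangles (H := 3000175332800) ht₀ hX hy₀ hy₁ hH
    (fun s hs h0 hT ↦ h₁ s hs h0 hT) hii hiii

/-! ## Certificate level (conditional on Thm. 1.3) -/

/-- **`Λ ≤ t₀ + y₀²/2` from a verified RH height, a winding certificate and a tail inequality**
(general parameters; conditional on Polymath 15, Thm. 1.3 = `effective_approximation`). Let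
`0 < t₀ ≤ 1/2`, `0 < y₀ < 1`, `X ≥ 200`, `X/2 ≤ H`. Assume: RH up to height `H`; on the box
`0 ≤ t ≤ t₀`, `X ≤ x ≤ X + 1` the Riemann–Siegel length `N = ⌊√(x/4π + t/16)⌋` does not depend on
`t` (`hN`) and the error majorant of Thm. 1.3 obeys `errAB + errC0 ≤ μ` for `t > 0`, `y₀ ≤ y ≤ 1`
(`herr`); for every `t ∈ [0, t₀]` a winding certificate with margin `μ` for `z ↦ f_t(z)` on
`[X, X+1] × [y₀, 1]` (`hcert`, Polymath 15, §8.4 in the format of `WindingCertGt`); and for all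
`x ≥ X`, `y₀ ≤ y ≤ 1` the inequality `errAB + errC0 < |f_{t₀}(x + iy)|` (`htail`, Polymath 15,
§8.3/§8.5 via Cor. 1.4). Then `H_t` has only real zeros for every `t > t₀ + y₀²/2`. Proof: the box
is zero-free by `box_zero_free_of_windingCert`, the half-strip by `deBruijnH_ne_zero_of_err_lt`
(Cor. 1.4; the half-strip lies in the region (1.6)), and `upper_bound_of_rectangles` concludes.
[cite: Polymath2019, Thm. 1.2, Cor. 1.4, §8.2–8.5] -/
theorem upper_bound_of_certificates (h : effective_approximation) {t₀ X y₀ H μ : ℝ}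
    (ht₀ : 0 < t₀) (ht₀' : t₀ ≤ 1 / 2) (hy₀ : 0 < y₀) (hy₀' : y₀ < 1) (hX : 200 ≤ X)
    (hH : X / 2 ≤ H) (hRH : DiophantineGeometry.RiemannHypothesisUpTo H)
    (hN : ∀ t ∈ Icc 0 t₀, ∀ x ∈ Icc X (X + 1), rsN t x = rsN 0 x)
    (herr : ∀ t ∈ Ioc 0 t₀, ∀ x ∈ Icc X (X + 1), ∀ y ∈ Icc y₀ 1, errAB t x y + errC0 t x y ≤ μ)
    (hcert : ∀ t ∈ Icc 0 t₀, WindingCertGt (fz t) μ X (X + 1) y₀ 1)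
    (htail : ∀ x y : ℝ, X ≤ x → y₀ ≤ y → y ≤ 1 → errAB t₀ x y + errC0 t₀ x y < ‖ft t₀ x y‖) :
    ∀ t : ℝ, t₀ + y₀ ^ 2 / 2 < t → HasOnlyRealZeros (deBruijnH t) := by
  refine upper_bound_of_rectangles ht₀ (by linarith) hy₀ hy₀'.le hH hRH (fun x y hx hy hy1 ↦ ?_)
    (box_zero_free_of_windingCert h ht₀ ht₀' hy₀.le hy₀' hX hN herr hcert)
  exact deBruijnH_ne_zero_of_err_lt h ⟨ht₀, ht₀', hy₀.le.trans hy, hy1, hX.trans hx⟩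
    (htail x y hx hy hy1)

/-- The `Λ`-form of `upper_bound_of_certificates`: `Λ ≤ t₀ + y₀²/2`.
[cite: Polymath2019, Thm. 1.2, Cor. 1.4, §8.2–8.5] -/
theorem deBruijnNewmanConst_le_of_certificates (h : effective_approximation) {t₀ X y₀ H μ : ℝ}
    (ht₀ : 0 < t₀) (ht₀' : t₀ ≤ 1 / 2) (hy₀ : 0 < y₀) (hy₀' : y₀ < 1) (hX : 200 ≤ X)
    (hH : X / 2 ≤ H) (hRH : DiophantineGeometry.RiemannHypothesisUpTo H)
    (hN : ∀ t ∈ Icc 0 t₀, ∀ x ∈ Icc X (X + 1), rsN t x = rsN 0 x)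
    (herr : ∀ t ∈ Ioc 0 t₀, ∀ x ∈ Icc X (X + 1), ∀ y ∈ Icc y₀ 1, errAB t x y + errC0 t x y ≤ μ)
    (hcert : ∀ t ∈ Icc 0 t₀, WindingCertGt (fz t) μ X (X + 1) y₀ 1)
    (htail : ∀ x y : ℝ, X ≤ x → y₀ ≤ y → y ≤ 1 → errAB t₀ x y + errC0 t₀ x y < ‖ft t₀ x y‖) :
    deBruijnNewmanConst ≤ t₀ + y₀ ^ 2 / 2 :=
  (deBruijnNewmanConst_le_iff_holds _).2
    (upper_bound_of_certificates h ht₀ ht₀' hy₀ hy₀' hX hH hRH hN herr hcert htail)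

/-- **Certificate level at the Platt–Trudgian height** (`platt_trudgian_numerical_rh`,
`H = 3 000 175 332 800`, so any `200 ≤ X ≤ 6 000 350 665 600`): conditional on Thm. 1.3, a
winding certificate for the box and the tail inequality on the half-strip give `Λ ≤ t₀ + y₀²/2`.
This is the statement each rung of the Track-2 ladder instantiates.
[cite: PlattTrudgianBLMS2021, Thm. 1 and §3.4] [cite: Polymath2019, Thm. 1.2, Cor. 1.4, §8.2–8.5] -/
theorem deBruijnNewmanConst_le_of_certificates_platt_trudgian (h₁ : LFunctions.platt_trudgian_numerical_rh)
    (h : effective_approximation) {t₀ X y₀ μ : ℝ} (ht₀ : 0 < t₀) (ht₀' : t₀ ≤ 1 / 2) (hy₀ : 0 < y₀)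
    (hy₀' : y₀ < 1) (hX : 200 ≤ X) (hH : X / 2 ≤ 3000175332800)
    (hN : ∀ t ∈ Icc 0 t₀, ∀ x ∈ Icc X (X + 1), rsN t x = rsN 0 x)
    (herr : ∀ t ∈ Ioc 0 t₀, ∀ x ∈ Icc X (X + 1), ∀ y ∈ Icc y₀ 1, errAB t x y + errC0 t x y ≤ μ)
    (hcert : ∀ t ∈ Icc 0 t₀, WindingCertGt (fz t) μ X (X + 1) y₀ 1)
    (htail : ∀ x y : ℝ, X ≤ x → y₀ ≤ y → y ≤ 1 → errAB t₀ x y + errC0 t₀ x y < ‖ft t₀ x y‖) :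
    deBruijnNewmanConst ≤ t₀ + y₀ ^ 2 / 2 :=
  deBruijnNewmanConst_le_of_certificates h (H := 3000175332800) ht₀ ht₀' hy₀ hy₀' hX hH
    (fun s hs h0 hT ↦ h₁ s hs h0 hT) hN herr hcert htail

/-! ## Table 1, row 2 at certificate level -/

/-- **Table 1, row 2 at certificate level, general height `H ≥ 2 500 000 097 429 = X/2`.**
Conditional on Thm. 1.3: RH to height `H`, a winding certificate with margin `1/500` for the row-2 box
(`N = 630783` and `errAB + errC0 ≤ 1/500` there are kernel-checked: `rsN_row2`, `err_row2`) and the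
row-2 tail inequality on `x ≥ 5·10¹² + 194858`, `0.16733 ≤ y ≤ 1` give `Λ ≤ 1/5` — i.e. exactly what,
as printed, Platt–Trudgian 2021, Cor. 2 takes from Polymath 15, §10 (the barrier run for row 2) plus
the asymptotic half that §10 describes as expected ("we … expect to be able to verify the hypothesis
… for any choice of parameters `t₀, y₀, N₀`"). [cite: Polymath2019, §10, Table 1 (row 2)]
[cite: PlattTrudgianBLMS2021, §3.4 and Cor. 2] -/
theorem deBruijnNewmanConst_le_one_fifth_of_row2_certificates (h : effective_approximation) {H : ℝ}
    (hH : (2500000097429 : ℝ) ≤ H) (hRH : DiophantineGeometry.RiemannHypothesisUpTo H)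
    (hcert : ∀ t ∈ Icc (0 : ℝ) 0.186, WindingCertGt (fz t) (1 / 500)
      (5 * 10 ^ 12 + 194858) (5 * 10 ^ 12 + 194858 + 1) 0.16733 1)
    (htail : ∀ x y : ℝ, (5 * 10 ^ 12 + 194858 : ℝ) ≤ x → (0.16733 : ℝ) ≤ y → y ≤ 1 →
      errAB 0.186 x y + errC0 0.186 x y < ‖ft 0.186 x y‖) :
    deBruijnNewmanConst ≤ 1 / 5 := by
  have hbox := table1_row2_barrier_box_of_windingCert h hcert
  have hii : ∀ x y : ℝ, (5 * 10 ^ 12 + 194858 : ℝ) ≤ x → (0.16733 : ℝ) ≤ y → y ≤ 1 →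
      deBruijnH 0.186 (x + y * I) ≠ 0 := fun x y hx hy hy1 ↦
    deBruijnH_ne_zero_of_err_lt h ⟨by norm_num, by norm_num, le_trans (by norm_num) hy, hy1,
      le_trans (by norm_num) hx⟩ (htail x y hx hy hy1)
  have hle : deBruijnNewmanConst ≤ 0.186 + 0.16733 ^ 2 / 2 :=
    deBruijnNewmanConst_le_of_rectangles (by norm_num) (by norm_num) (by norm_num) (by norm_num)
      (le_trans (by norm_num : (5 * 10 ^ 12 + 194858 : ℝ) / 2 ≤ 2500000097429) hH) hRH hii hbox
  exact hle.trans (by norm_num)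

end Polymath15

end Literature.NumberTheory.LFunctions

end
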